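import Summits.QuantumFields.YangMills.Theorems.ColdStartUniversalityLatticeLangevinLoopStringMixing
import Summits.QuantumFields.YangMills.Theorems.ColdStartUniversalityUniformColdStartMixingNearUniformOfLogSobolev
import HarnessLib

/-!
# Route `ColdStartUniversality`, aside K_A1 `UniformColdStartMixing` (24809), LINE 4 «cold_entropy»: LOOP STRINGS from log-Sobolev(`ρ`) and
# (ULS) ALONE ⇒ NEAR-UNIFORM (log(1/ε_K)) cold-start equilibration of PRODUCTS of torus-averaged Wilson loops

Helper file (seat `ym-line-csu-p1`, g28; `--supports stmt-QuantumFields-24809`).  The crux tests products `∏_(C∈os)` of averaged loop observables;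
here the `ρ`-parametric transport bound (`…TransportMixingOfLogSobolevColdStart`) meets the loop-string carré bound `Γ(∏_k W̄_k) ≤ 96(Σ_k(R_k+T_k))²/#sites`
(`…LoopStringMixing`):
* ★★ `wilson_coldStart_loopString_le_exp_of_logSobolev` / `…_le_coupling_of_logSobolev` — under a HYPOTHESIS log-Sobolev inequality with constant `ρ`
  (every `β'`): `|E ∏_k W̄_k(U_(2+u)) − ∫∏_k W̄_k dμ_(β')| ≤ e^(−2ρu)·(Σ_k(R_k+T_k))·√(48(366|β'|+3)/ρ)`;
* ★★★ `nearUniform_loopString_coldStart_of_uniformLogSobolev` / `…_physicalTime_…` — under the route's K-uniform (ULS): the same at the cut-offs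
  (`ρ = cε_K`, `β' = β'_K`), and POINTWISE in physical time `s ≥ 2ε_K + log(C_K/δ)/(2c)`, `C_K = (Σ_k(R_k+T_k))√(48(366β'_K+3)/(cε_K))`, i.e. a threshold
  `O(log(1/ε_K))` (`nearUniform_threshold_le_log` with `A = Σ_k(R_k+T_k)`; for loops of fixed PHYSICAL size `R_k+T_k ≍ 1/ε_K` one more `log(1/ε_K)/(2c)`).
PLANNER-FACING, HONEST: (ULS) is K-UNIFORM and OPEN; torus-wide `Re tr` averages, not the crux's block averages `avgObs expMeanLogSU`; nothing K-uniform is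
proved; 24809 is ASIDE and NOT restated; no crux, rung or summit statement is proved; the Yang–Mills mass gap is NOT proved.  THEOREMS ONLY, no definition,
no sorry. [cite: BakryGentilLedoux2014, Thm 5.2.1]
-/

set_option autoImplicit false

noncomputable section

namespace Summit.QuantumFields.YangMills.Theorems.ColdStartUniversality

open MeasureTheory ProbabilityTheory Finset Filter Set InformationTheory
open scoped BigOperators NNReal ENNReal Topology Matrix
open Literature.Probability.Process Literature.MathematicalPhysics.QuantumFieldTheory
open Literature.MathematicalPhysics.QuantumLattice (fundamentalRep fundamentalLatticeRep continuous_fundamentalRep)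
open Literature.MathematicalPhysics.QuantumFieldTheory.Balaban1983to89

/-! ## §1. Loop strings from log-Sobolev(`ρ`) -/

/-- ★★ **Cold-start equilibration of a loop string from log-Sobolev(`ρ`)** (every `β'`, `Σ_k(R_k+T_k) > 0`): for every deterministic start,
every solution and every `u ≥ 0`,
`|E ∏_k W̄_k(U_(2+u)) − ∫ ∏_k W̄_k dμ_(β')| ≤ e^(−2ρu)·√(96(Σ_k(R_k+T_k))²·(366|β'|L³ + 3log(3/2)L³ + log 2)/(#sites·2ρ))`.
[cite: BakryGentilLedoux2014, Thm 5.2.1] -/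
theorem wilson_coldStart_loopString_le_exp_of_logSobolev (L : ℕ) [NeZero L] (β' : ℝ) (m : ℕ) {ρ : ℝ} (hρ : 0 < ρ) (i j : Fin m → Fin 3)
    (R T : Fin m → ℕ) (hRT : 0 < ∑ k, (R k + T k)) (z : (GaugeConfig 3 L (Matrix.specialUnitaryGroup (Fin 2) ℂ)))
    (hLSgen : ∀ (f : (Edge 3 L × Fin 2 × Fin 2 × Bool → ℝ) → ℝ), ContDiff ℝ 3 f →
        let coords : GaugeConfig 3 L (Matrix.specialUnitaryGroup (Fin 2) ℂ) → (Edge 3 L × Fin 2 × Fin 2 × Bool → ℝ) :=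
          fun V q => (fun z : ℂ => if q.2.2.2 then z.im else z.re)
            ((fundamentalRep (Fin 2) (V q.1) : Matrix (Fin 2) (Fin 2) ℂ) q.2.1 q.2.2.1)
        let gen : GaugeConfig 3 L (Matrix.specialUnitaryGroup (Fin 2) ℂ) → ℝ := fun V =>
          (∑ i : Edge 3 L × Fin 2 × Fin 2 × Bool, fderiv ℝ f (coords V) (Pi.single i 1) *
              (fun z : ℂ => if i.2.2.2 then z.im else z.re)
                ((latticeLangevinDynamics (fundamentalLatticeRep 2) β').drift
                  (matrixConfig (fundamentalRep (Fin 2)) V) i.1 i.2.1 i.2.2.1) +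
          1 / 2 * ∑ i : Edge 3 L × Fin 2 × Fin 2 × Bool, ∑ j : Edge 3 L × Fin 2 × Fin 2 × Bool,
            fderiv ℝ (fun z => fderiv ℝ f z (Pi.single i 1)) (coords V) (Pi.single j 1) *
              ∑ n : Edge 3 L × NoiseIdx 2,
                (if n.1 = i.1 then (fun z : ℂ => if i.2.2.2 then z.im else z.re)
                  ((latticeLangevinDynamics (fundamentalLatticeRep 2) β').noise
                    (matrixConfig (fundamentalRep (Fin 2)) V) i.1 n.2 i.2.1 i.2.2.1) else 0) *
                (if n.1 = j.1 then (fun z : ℂ => if j.2.2.2 then z.im else z.re)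
                  ((latticeLangevinDynamics (fundamentalLatticeRep 2) β').noise
                    (matrixConfig (fundamentalRep (Fin 2)) V) j.1 n.2 j.2.1 j.2.2.1) else 0))
        ρ * ((∫ V, f (coords V) ^ 2 * Real.log (f (coords V) ^ 2) ∂(wilsonMeasure (d := 3) (L := L) (fundamentalRep (Fin 2)) β')) -
            (∫ V, f (coords V) ^ 2 ∂(wilsonMeasure (d := 3) (L := L) (fundamentalRep (Fin 2)) β')) *
              Real.log (∫ V, f (coords V) ^ 2 ∂(wilsonMeasure (d := 3) (L := L) (fundamentalRep (Fin 2)) β'))) ≤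
          -∫ V, f (coords V) * gen V ∂(wilsonMeasure (d := 3) (L := L) (fundamentalRep (Fin 2)) β'))
    {Ω : Type} [MeasurableSpace Ω] {P : Measure Ω} [IsProbabilityMeasure P]
    {W : ℝ≥0 → Ω → (Edge 3 L × NoiseIdx 2 → ℝ)} (hW : IsFlatBrownian W P)
    {U : ℝ≥0 → Ω → (GaugeConfig 3 L (Matrix.specialUnitaryGroup (Fin 2) ℂ))} (hU0 : ∀ ω, U 0 ω = z)
    (hU : (latticeLangevinDynamics (fundamentalLatticeRep 2) β').IsSolution (fundamentalRep (Fin 2)) hW.natFiltration P W U)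
    (u : ℝ≥0) :
    |(∫ ω, (∏ k : Fin m, (((Fintype.card (Site 3 L) : ℝ))⁻¹ * ∑ x : Site 3 L, wilsonLoop (fundamentalRep (Fin 2)) x (i k) (j k) (R k) (T k) (U ((2 : ℝ≥0) + u) ω))) ∂P) - ∫ V, (∏ k : Fin m, (((Fintype.card (Site 3 L) : ℝ))⁻¹ * ∑ x : Site 3 L, wilsonLoop (fundamentalRep (Fin 2)) x (i k) (j k) (R k) (T k) V)) ∂(wilsonMeasure (d := 3) (L := L) (fundamentalRep (Fin 2)) β')| ≤
      Real.exp (-(2 * ρ) * u) * Real.sqrt (96 * (∑ k : Fin m, ((R k : ℝ) + T k)) ^ 2 * (366 * |β'| * (L : ℝ) ^ 3 + 3 * Real.log (3 / 2) * (L : ℝ) ^ 3 + Real.log 2) / ((Fintype.card (Site 3 L) : ℝ) * (2 * ρ))) := by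
  classical
  haveI := secondCountableTopology_su2
  haveI := borelSpace_config L
  set μ : Measure (GaugeConfig 3 L (Matrix.specialUnitaryGroup (Fin 2) ℂ)) := (wilsonMeasure (d := 3) (L := L) (fundamentalRep (Fin 2)) β') with hμ
  haveI : IsProbabilityMeasure μ :=
    isProbabilityMeasure_wilsonMeasure (d := 3) (L := L) (fundamentalRep (Fin 2)) (continuous_fundamentalRep (Fin 2)) β'
  have h2ρ : 0 < 2 * ρ := by positivity
  have hS : (0 : ℝ) < (Fintype.card (Site 3 L) : ℝ) := card_site_three_pos L
  have hRT' : (0 : ℝ) < (∑ k : Fin m, ((R k : ℝ) + T k)) := by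
    have h : ((∑ k, (R k + T k) : ℕ) : ℝ) = (∑ k : Fin m, ((R k : ℝ) + T k)) := by push_cast; rfl
    rw [← h]; exact_mod_cast hRT
  set co : (GaugeConfig 3 L (Matrix.specialUnitaryGroup (Fin 2) ℂ)) → (Edge 3 L × Fin 2 × Fin 2 × Bool → ℝ) := (fun (V : GaugeConfig 3 L (Matrix.specialUnitaryGroup (Fin 2) ℂ)) (q : Edge 3 L × Fin 2 × Fin 2 × Bool) => (fun z : ℂ => if q.2.2.2 then z.im else z.re) ((fundamentalRep (Fin 2) (V q.1) : Matrix (Fin 2) (Fin 2) ℂ) q.2.1 q.2.2.1)) with hco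
  set F : Fin m → (Edge 3 L × Fin 2 × Fin 2 × Bool → ℝ) → ℝ := fun k => (fun y : (Edge 3 L × Fin 2 × Fin 2 × Bool → ℝ) => (2 * (Fintype.card (Site 3 L) : ℝ))⁻¹ * ∑ x : Site 3 L, ((((((List.range (R k)).map (fun m : ℕ => ((Pi.single (i k) ((m : ℕ) : ZMod L) : Site 3 L), (i k), false)) ++ (List.range (T k)).map (fun m : ℕ => ((Pi.single (i k) (((R k) : ℕ) : ZMod L) : Site 3 L) + (Pi.single (j k) ((m : ℕ) : ZMod L) : Site 3 L), (j k), false)) ++ ((List.range (R k)).map (fun m : ℕ => ((Pi.single (j k) (((T k) : ℕ) : ZMod L) : Site 3 L) + (Pi.single (i k) ((m : ℕ) : ZMod L) : Site 3 L), (i k), true))).reverse ++ ((List.range (T k)).map (fun m : ℕ => ((Pi.single (j k) ((m : ℕ) : ZMod L) : Site 3 L), (j k), true))).reverse).map (fun q : Site 3 L × Fin 3 × Bool => ((x + q.1, q.2.1), q.2.2))).map (fun a : Edge 3 L × Bool => if a.2 then ((fun (ee : Edge 3 L) => Matrix.of fun (i' j' : Fin 2) => ((y (ee, i', j', false) : ℝ)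 : ℂ) + ((y (ee, i', j', true) : ℝ) : ℂ) * Complex.I) a.1)ᴴ else (fun (ee : Edge 3 L) => Matrix.of fun (i' j' : Fin 2) => ((y (ee, i', j', false) : ℝ) : ℂ) + ((y (ee, i', j', true) : ℝ) : ℂ) * Complex.I) a.1)).prod)).trace.re) with hFdef
  have hfC : ContDiff ℝ 3 (fun y => ∏ k : Fin m, F k y) := contDiff_prod (fun k _ => contDiff_loopAverage _ _)
  have hval : ∀ (k) (V : (GaugeConfig 3 L (Matrix.specialUnitaryGroup (Fin 2) ℂ))), F k (co V) = (((Fintype.card (Site 3 L) : ℝ))⁻¹ * ∑ x : Site 3 L, wilsonLoop (fundamentalRep (Fin 2)) x (i k) (j k) (R k) (T k) V) :=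
    fun k V => loopAverage_coords_eq V (i k) (j k) (R k) (T k)
  have hvalP : ∀ V : (GaugeConfig 3 L (Matrix.specialUnitaryGroup (Fin 2) ℂ)), (fun y => ∏ k : Fin m, F k y) (co V) = (∏ k : Fin m, (((Fintype.card (Site 3 L) : ℝ))⁻¹ * ∑ x : Site 3 L, wilsonLoop (fundamentalRep (Fin 2)) x (i k) (j k) (R k) (T k) V)) :=
    fun V => Finset.prod_congr rfl fun k _ => hval k V
  have hs : 0 < 96 * (∑ k : Fin m, ((R k : ℝ) + T k)) ^ 2 / (Fintype.card (Site 3 L) : ℝ) := by positivity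
  have hmain : |(∫ ω, (fun y => ∏ k : Fin m, F k y) (co (U ((2 : ℝ≥0) + u) ω)) ∂P) - ∫ V, (fun y => ∏ k : Fin m, F k y) (co V) ∂μ| ≤
      Real.exp (-(2 * ρ) * u) * Real.sqrt ((96 * (∑ k : Fin m, ((R k : ℝ) + T k)) ^ 2 / (Fintype.card (Site 3 L) : ℝ)) * (366 * |β'| * (L : ℝ) ^ 3 + 3 * Real.log (3 / 2) * (L : ℝ) ^ 3 + Real.log 2) / (2 * ρ)) :=
    wilson_coldStart_smooth_le_exp_of_logSobolev_explicit L β' (fun y => ∏ k : Fin m, F k y) hρ hfC hs hLSgen hW z hU0 hU u (wilson_loopString_carre_le L β' m i j R T)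
  have hEP : ∫ ω, (fun y => ∏ k : Fin m, F k y) (co (U ((2 : ℝ≥0) + u) ω)) ∂P = ∫ ω, (∏ k : Fin m, (((Fintype.card (Site 3 L) : ℝ))⁻¹ * ∑ x : Site 3 L, wilsonLoop (fundamentalRep (Fin 2)) x (i k) (j k) (R k) (T k) (U ((2 : ℝ≥0) + u) ω))) ∂P :=
    integral_congr_ae (ae_of_all _ fun ω => hvalP _)
  have hEμ : ∫ V, (fun y => ∏ k : Fin m, F k y) (co V) ∂μ = ∫ V, (∏ k : Fin m, (((Fintype.card (Site 3 L) : ℝ))⁻¹ * ∑ x : Site 3 L, wilsonLoop (fundamentalRep (Fin 2)) x (i k) (j k) (R k) (T k) V)) ∂μ :=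
    integral_congr_ae (ae_of_all _ fun V => hvalP V)
  have e2 : (96 * (∑ k : Fin m, ((R k : ℝ) + T k)) ^ 2 / (Fintype.card (Site 3 L) : ℝ)) * (366 * |β'| * (L : ℝ) ^ 3 + 3 * Real.log (3 / 2) * (L : ℝ) ^ 3 + Real.log 2) / (2 * ρ) =
      96 * (∑ k : Fin m, ((R k : ℝ) + T k)) ^ 2 * (366 * |β'| * (L : ℝ) ^ 3 + 3 * Real.log (3 / 2) * (L : ℝ) ^ 3 + Real.log 2) / ((Fintype.card (Site 3 L) : ℝ) * (2 * ρ)) := by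
    field_simp
  rw [hEP, hEμ, e2] at hmain
  exact hmain

/-- ★★ **Volume factors cancelled** (loop strings, log-Sobolev(`ρ`)): `|E ∏_k W̄_k(U_(2+u)) − ∫ ∏_k W̄_k dμ_(β')| ≤
e^(−2ρu)·(Σ_k(R_k+T_k))·√(48(366|β'| + 3)/ρ)` — the prefactor depends on `L`, `β'` only through `β'` and `ρ`. [cite: BakryGentilLedoux2014, Thm 5.2.1] -/
theorem wilson_coldStart_loopString_le_coupling_of_logSobolev (L : ℕ) [NeZero L] (β' : ℝ) (m : ℕ) (i j : Fin m → Fin 3) {ρ : ℝ} (hρ : 0 < ρ)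
    (R T : Fin m → ℕ) (hRT : 0 < ∑ k, (R k + T k)) (z : (GaugeConfig 3 L (Matrix.specialUnitaryGroup (Fin 2) ℂ)))
    (hLSgen : ∀ (f : (Edge 3 L × Fin 2 × Fin 2 × Bool → ℝ) → ℝ), ContDiff ℝ 3 f →
        let coords : GaugeConfig 3 L (Matrix.specialUnitaryGroup (Fin 2) ℂ) → (Edge 3 L × Fin 2 × Fin 2 × Bool → ℝ) :=
          fun V q => (fun z : ℂ => if q.2.2.2 then z.im else z.re)
            ((fundamentalRep (Fin 2) (V q.1) : Matrix (Fin 2) (Fin 2) ℂ) q.2.1 q.2.2.1)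
        let gen : GaugeConfig 3 L (Matrix.specialUnitaryGroup (Fin 2) ℂ) → ℝ := fun V =>
          (∑ i : Edge 3 L × Fin 2 × Fin 2 × Bool, fderiv ℝ f (coords V) (Pi.single i 1) *
              (fun z : ℂ => if i.2.2.2 then z.im else z.re)
                ((latticeLangevinDynamics (fundamentalLatticeRep 2) β').drift
                  (matrixConfig (fundamentalRep (Fin 2)) V) i.1 i.2.1 i.2.2.1) +
          1 / 2 * ∑ i : Edge 3 L × Fin 2 × Fin 2 × Bool, ∑ j : Edge 3 L × Fin 2 × Fin 2 × Bool,
            fderiv ℝ (fun z => fderiv ℝ f z (Pi.single i 1)) (coords V) (Pi.single j 1) *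
              ∑ n : Edge 3 L × NoiseIdx 2,
                (if n.1 = i.1 then (fun z : ℂ => if i.2.2.2 then z.im else z.re)
                  ((latticeLangevinDynamics (fundamentalLatticeRep 2) β').noise
                    (matrixConfig (fundamentalRep (Fin 2)) V) i.1 n.2 i.2.1 i.2.2.1) else 0) *
                (if n.1 = j.1 then (fun z : ℂ => if j.2.2.2 then z.im else z.re)
                  ((latticeLangevinDynamics (fundamentalLatticeRep 2) β').noise
                    (matrixConfig (fundamentalRep (Fin 2)) V) j.1 n.2 j.2.1 j.2.2.1) else 0))
        ρ * ((∫ V, f (coords V) ^ 2 * Real.log (f (coords V) ^ 2) ∂(wilsonMeasure (d := 3) (L := L) (fundamentalRep (Fin 2)) β')) -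
            (∫ V, f (coords V) ^ 2 ∂(wilsonMeasure (d := 3) (L := L) (fundamentalRep (Fin 2)) β')) *
              Real.log (∫ V, f (coords V) ^ 2 ∂(wilsonMeasure (d := 3) (L := L) (fundamentalRep (Fin 2)) β'))) ≤
          -∫ V, f (coords V) * gen V ∂(wilsonMeasure (d := 3) (L := L) (fundamentalRep (Fin 2)) β'))
    {Ω : Type} [MeasurableSpace Ω] {P : Measure Ω} [IsProbabilityMeasure P]
    {W : ℝ≥0 → Ω → (Edge 3 L × NoiseIdx 2 → ℝ)} (hW : IsFlatBrownian W P)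
    {U : ℝ≥0 → Ω → (GaugeConfig 3 L (Matrix.specialUnitaryGroup (Fin 2) ℂ))} (hU0 : ∀ ω, U 0 ω = z)
    (hU : (latticeLangevinDynamics (fundamentalLatticeRep 2) β').IsSolution (fundamentalRep (Fin 2)) hW.natFiltration P W U)
    (u : ℝ≥0) :
    |(∫ ω, (∏ k : Fin m, (((Fintype.card (Site 3 L) : ℝ))⁻¹ * ∑ x : Site 3 L, wilsonLoop (fundamentalRep (Fin 2)) x (i k) (j k) (R k) (T k) (U ((2 : ℝ≥0) + u) ω))) ∂P) - ∫ V, (∏ k : Fin m, (((Fintype.card (Site 3 L) : ℝ))⁻¹ * ∑ x : Site 3 L, wilsonLoop (fundamentalRep (Fin 2)) x (i k) (j k) (R k) (T k) V)) ∂(wilsonMeasure (d := 3) (L := L) (fundamentalRep (Fin 2)) β')| ≤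
      Real.exp (-(2 * ρ) * u) * ((∑ k : Fin m, ((R k : ℝ) + T k)) * Real.sqrt (48 * (366 * |β'| + 3) / ρ)) := by
  have h2ρ : 0 < 2 * ρ := by positivity
  have hRT' : (0 : ℝ) < (∑ k : Fin m, ((R k : ℝ) + T k)) := by
    have h : ((∑ k, (R k + T k) : ℕ) : ℝ) = (∑ k : Fin m, ((R k : ℝ) + T k)) := by push_cast; rfl
    rw [← h]; exact_mod_cast hRT
  have h := wilson_coldStart_loopString_le_exp_of_logSobolev L β' m hρ i j R T hRT z hLSgen hW hU0 hU u
  refine h.trans (mul_le_mul_of_nonneg_left ?_ (Real.exp_pos _).le)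
  obtain ⟨S, hSdef⟩ : ∃ S : ℝ, (∑ k : Fin m, ((R k : ℝ) + T k)) = S := ⟨_, rfl⟩
  rw [hSdef] at hRT' ⊢
  have hSite : (Fintype.card (Site 3 L) : ℝ) = (L : ℝ) ^ 3 := by
    rw [card_site_three]; push_cast; ring
  have hL1 : (1 : ℝ) ≤ (L : ℝ) := by exact_mod_cast Nat.one_le_iff_ne_zero.2 (NeZero.ne L)
  have hL3 : (1 : ℝ) ≤ (L : ℝ) ^ 3 := one_le_pow₀ hL1
  have hL30 : (0 : ℝ) < (L : ℝ) ^ 3 := by positivity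
  have h32 : Real.log (3 / 2 : ℝ) ≤ 1 / 2 := by
    have := Real.log_le_sub_one_of_pos (by norm_num : (0 : ℝ) < 3 / 2); linarith
  have h2 : Real.log (2 : ℝ) ≤ 1 := by
    have := Real.log_le_sub_one_of_pos (by norm_num : (0 : ℝ) < 2); linarith
  have hB : (366 * |β'| * (L : ℝ) ^ 3 + 3 * Real.log (3 / 2) * (L : ℝ) ^ 3 + Real.log 2) ≤ (366 * |β'| + 3) * (L : ℝ) ^ 3 := by
    nlinarith [mul_le_mul_of_nonneg_right h32 hL30.le, abs_nonneg β']
  have hq : 96 * S ^ 2 * (366 * |β'| * (L : ℝ) ^ 3 + 3 * Real.log (3 / 2) * (L : ℝ) ^ 3 + Real.log 2) / ((Fintype.card (Site 3 L) : ℝ) * (2 * ρ)) ≤ (S * Real.sqrt (48 * (366 * |β'| + 3) / ρ)) ^ 2 := by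
    rw [mul_pow, Real.sq_sqrt (by positivity), hSite]
    rw [div_le_iff₀ (by positivity)]
    have hS2 : 0 < S ^ 2 := by positivity
    have e : S ^ 2 * (48 * (366 * |β'| + 3) / ρ) * ((L : ℝ) ^ 3 * (2 * ρ)) = 96 * S ^ 2 * ((366 * |β'| + 3) * (L : ℝ) ^ 3) := by
      field_simp
      ring
    rw [e]
    exact mul_le_mul_of_nonneg_left hB (by positivity)
  exact (Real.sqrt_le_sqrt hq).trans (le_of_eq (Real.sqrt_sq (by positivity)))

/-! ## §2. (ULS) ⇒ near-uniform equilibration of loop strings -/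

/-- ★★★ **(ULS) alone ⇒ near-uniform cold-start equilibration of LOOP STRINGS** (products of torus-averaged `R_k × T_k` Wilson loops,
`Σ_k(R_k+T_k) > 0` — the crux's product shape): `∃γ₁>0 ∀F, 0<γ≤γ₁ ⇒ ∃c>0 ∃K₀ ∀K≥K₀`, every solution at `β'_K` from any deterministic start,
every lattice time `u ≥ 0`: `|E ∏_k W̄_k(U_(2+u)) − ∫∏_k W̄_k dμ_K| ≤ e^(−2cε_K u)·(Σ_k(R_k+T_k))·√(48(366β'_K + 3)/(cε_K))`. [cite: BakryGentilLedoux2014, Thm 5.2.1] -/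
theorem nearUniform_loopString_coldStart_of_uniformLogSobolev
    (hULS : ∃ γ₁ : ℝ, 0 < γ₁ ∧ ∀ (F : T3ContinuumYM3Torus.T3Family) (γ : ℝ), 0 < γ → γ ≤ γ₁ →
      ∃ c : ℝ, 0 < c ∧ ∃ K₀ : ℕ, ∀ K : ℕ, K₀ ≤ K →
        ∀ (f : (Edge 3 ((F.P K).sitesPerDir 0) × Fin 2 × Fin 2 × Bool → ℝ) → ℝ), ContDiff ℝ 3 f →
        let coords : GaugeConfig 3 ((F.P K).sitesPerDir 0) (Matrix.specialUnitaryGroup (Fin 2) ℂ) →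
            (Edge 3 ((F.P K).sitesPerDir 0) × Fin 2 × Fin 2 × Bool → ℝ) :=
          fun V q => (fun z : ℂ => if q.2.2.2 then z.im else z.re)
            ((fundamentalRep (Fin 2) (V q.1) : Matrix (Fin 2) (Fin 2) ℂ) q.2.1 q.2.2.1)
        let gen : GaugeConfig 3 ((F.P K).sitesPerDir 0) (Matrix.specialUnitaryGroup (Fin 2) ℂ) → ℝ := fun V =>
          (∑ i : Edge 3 ((F.P K).sitesPerDir 0) × Fin 2 × Fin 2 × Bool, fderiv ℝ f (coords V) (Pi.single i 1) *
              (fun z : ℂ => if i.2.2.2 then z.im else z.re)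
                ((latticeLangevinDynamics (fundamentalLatticeRep 2) ((γ * (F.P K).eps)⁻¹ / 2)).drift
                  (matrixConfig (fundamentalRep (Fin 2)) V) i.1 i.2.1 i.2.2.1) +
          1 / 2 * ∑ i : Edge 3 ((F.P K).sitesPerDir 0) × Fin 2 × Fin 2 × Bool,
            ∑ j : Edge 3 ((F.P K).sitesPerDir 0) × Fin 2 × Fin 2 × Bool,
            fderiv ℝ (fun z => fderiv ℝ f z (Pi.single i 1)) (coords V) (Pi.single j 1) *
              ∑ n : Edge 3 ((F.P K).sitesPerDir 0) × NoiseIdx 2,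
                (if n.1 = i.1 then (fun z : ℂ => if i.2.2.2 then z.im else z.re)
                  ((latticeLangevinDynamics (fundamentalLatticeRep 2) ((γ * (F.P K).eps)⁻¹ / 2)).noise
                    (matrixConfig (fundamentalRep (Fin 2)) V) i.1 n.2 i.2.1 i.2.2.1) else 0) *
                (if n.1 = j.1 then (fun z : ℂ => if j.2.2.2 then z.im else z.re)
                  ((latticeLangevinDynamics (fundamentalLatticeRep 2) ((γ * (F.P K).eps)⁻¹ / 2)).noise
                    (matrixConfig (fundamentalRep (Fin 2)) V) j.1 n.2 j.2.1 j.2.2.1) else 0))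
        c * (F.P K).eps *
            ((∫ V, f (coords V) ^ 2 * Real.log (f (coords V) ^ 2)
                ∂(wilsonMeasure (d := 3) (L := (F.P K).sitesPerDir 0) (fundamentalRep (Fin 2)) ((γ * (F.P K).eps)⁻¹ / 2))) -
              (∫ V, f (coords V) ^ 2
                ∂(wilsonMeasure (d := 3) (L := (F.P K).sitesPerDir 0) (fundamentalRep (Fin 2)) ((γ * (F.P K).eps)⁻¹ / 2))) *
                Real.log (∫ V, f (coords V) ^ 2
                  ∂(wilsonMeasure (d := 3) (L := (F.P K).sitesPerDir 0) (fundamentalRep (Fin 2)) ((γ * (F.P K).eps)⁻¹ / 2)))) ≤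
          -∫ V, f (coords V) * gen V
            ∂(wilsonMeasure (d := 3) (L := (F.P K).sitesPerDir 0) (fundamentalRep (Fin 2)) ((γ * (F.P K).eps)⁻¹ / 2))) :
    ∃ γ₁ : ℝ, 0 < γ₁ ∧ ∀ (F : T3ContinuumYM3Torus.T3Family) (γ : ℝ), 0 < γ → γ ≤ γ₁ →
      ∃ c : ℝ, 0 < c ∧ ∃ K₀ : ℕ, ∀ K : ℕ, K₀ ≤ K →
        ∀ (m : ℕ) (i j : Fin m → Fin 3) (R T : Fin m → ℕ), 0 < ∑ k, (R k + T k) →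
        ∀ (z : GaugeConfig 3 ((F.P K).sitesPerDir 0) (Matrix.specialUnitaryGroup (Fin 2) ℂ))
          (Ω : Type) (mΩ : MeasurableSpace Ω) (P : Measure Ω) (hP : IsProbabilityMeasure P)
          (W : ℝ≥0 → Ω → (Edge 3 ((F.P K).sitesPerDir 0) × NoiseIdx 2 → ℝ)) (hW : IsFlatBrownian W P)
          (U : ℝ≥0 → Ω → GaugeConfig 3 ((F.P K).sitesPerDir 0) (Matrix.specialUnitaryGroup (Fin 2) ℂ)),
          (∀ ω, U 0 ω = z) →
          (latticeLangevinDynamics (fundamentalLatticeRep 2) ((γ * (F.P K).eps)⁻¹ / 2)).IsSolution (fundamentalRep (Fin 2)) hW.natFiltration P W U →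
          ∀ u : ℝ≥0,
            |(∫ ω, (∏ k : Fin m, (((Fintype.card (Site 3 ((F.P K).sitesPerDir 0)) : ℝ))⁻¹ * ∑ x : Site 3 ((F.P K).sitesPerDir 0), wilsonLoop (fundamentalRep (Fin 2)) x (i k) (j k) (R k) (T k) (U ((2 : ℝ≥0) + u) ω))) ∂P) - ∫ V, (∏ k : Fin m, (((Fintype.card (Site 3 ((F.P K).sitesPerDir 0)) : ℝ))⁻¹ * ∑ x : Site 3 ((F.P K).sitesPerDir 0), wilsonLoop (fundamentalRep (Fin 2)) x (i k) (j k) (R k) (T k) V)) ∂(wilsonMeasure (d := 3) (L := ((F.P K).sitesPerDir 0)) (fundamentalRep (Fin 2)) ((γ * (F.P K).eps)⁻¹ / 2))| ≤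
              Real.exp (-(2 * (c * (F.P K).eps)) * u) * ((∑ k : Fin m, ((R k : ℝ) + T k)) * Real.sqrt (48 * (366 * |(γ * (F.P K).eps)⁻¹ / 2| + 3) / (c * (F.P K).eps))) := by
  obtain ⟨γ₁, hγ₁, h⟩ := hULS
  refine ⟨γ₁, hγ₁, fun F γ hγ hγ1 => ?_⟩
  obtain ⟨c, hc, K₀, hK⟩ := h F γ hγ hγ1
  refine ⟨c, hc, K₀, fun K hKK m i j R T hRT z Ω mΩ P hP W hW U hU0 hU u => ?_⟩
  have hρ : 0 < c * (F.P K).eps := mul_pos hc (F.P K).eps_pos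
  exact wilson_coldStart_loopString_le_coupling_of_logSobolev ((F.P K).sitesPerDir 0) ((γ * (F.P K).eps)⁻¹ / 2) m i j hρ R T hRT z (hK K hKK) hW hU0 hU u

/-- ★★★ **(ULS) ⇒ pointwise-in-physical-time equilibration of loop strings with threshold `2ε_K + log(C_K/δ)/(2c)`**,
`C_K = (Σ_k(R_k+T_k))·√(48(366β'_K + 3)/(cε_K))` (so the threshold is `O(log(1/ε_K))`, cf. `nearUniform_threshold_le_log` with `A = Σ_k(R_k+T_k)`):
for `s ≥ 2ε_K` and `s ≥ 2ε_K + log(C_K/δ)/(2c)`, `|E ∏_k W̄_k(U(s/ε_K)) − ∫∏_k W̄_k dμ_K| ≤ δ`. [cite: BakryGentilLedoux2014, Thm 5.2.1] -/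
theorem nearUniform_loopString_physicalTime_of_uniformLogSobolev
    (hULS : ∃ γ₁ : ℝ, 0 < γ₁ ∧ ∀ (F : T3ContinuumYM3Torus.T3Family) (γ : ℝ), 0 < γ → γ ≤ γ₁ →
      ∃ c : ℝ, 0 < c ∧ ∃ K₀ : ℕ, ∀ K : ℕ, K₀ ≤ K →
        ∀ (f : (Edge 3 ((F.P K).sitesPerDir 0) × Fin 2 × Fin 2 × Bool → ℝ) → ℝ), ContDiff ℝ 3 f →
        let coords : GaugeConfig 3 ((F.P K).sitesPerDir 0) (Matrix.specialUnitaryGroup (Fin 2) ℂ) →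
            (Edge 3 ((F.P K).sitesPerDir 0) × Fin 2 × Fin 2 × Bool → ℝ) :=
          fun V q => (fun z : ℂ => if q.2.2.2 then z.im else z.re)
            ((fundamentalRep (Fin 2) (V q.1) : Matrix (Fin 2) (Fin 2) ℂ) q.2.1 q.2.2.1)
        let gen : GaugeConfig 3 ((F.P K).sitesPerDir 0) (Matrix.specialUnitaryGroup (Fin 2) ℂ) → ℝ := fun V =>
          (∑ i : Edge 3 ((F.P K).sitesPerDir 0) × Fin 2 × Fin 2 × Bool, fderiv ℝ f (coords V) (Pi.single i 1) *
              (fun z : ℂ => if i.2.2.2 then z.im else z.re)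
                ((latticeLangevinDynamics (fundamentalLatticeRep 2) ((γ * (F.P K).eps)⁻¹ / 2)).drift
                  (matrixConfig (fundamentalRep (Fin 2)) V) i.1 i.2.1 i.2.2.1) +
          1 / 2 * ∑ i : Edge 3 ((F.P K).sitesPerDir 0) × Fin 2 × Fin 2 × Bool,
            ∑ j : Edge 3 ((F.P K).sitesPerDir 0) × Fin 2 × Fin 2 × Bool,
            fderiv ℝ (fun z => fderiv ℝ f z (Pi.single i 1)) (coords V) (Pi.single j 1) *
              ∑ n : Edge 3 ((F.P K).sitesPerDir 0) × NoiseIdx 2,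
                (if n.1 = i.1 then (fun z : ℂ => if i.2.2.2 then z.im else z.re)
                  ((latticeLangevinDynamics (fundamentalLatticeRep 2) ((γ * (F.P K).eps)⁻¹ / 2)).noise
                    (matrixConfig (fundamentalRep (Fin 2)) V) i.1 n.2 i.2.1 i.2.2.1) else 0) *
                (if n.1 = j.1 then (fun z : ℂ => if j.2.2.2 then z.im else z.re)
                  ((latticeLangevinDynamics (fundamentalLatticeRep 2) ((γ * (F.P K).eps)⁻¹ / 2)).noise
                    (matrixConfig (fundamentalRep (Fin 2)) V) j.1 n.2 j.2.1 j.2.2.1) else 0))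
        c * (F.P K).eps *
            ((∫ V, f (coords V) ^ 2 * Real.log (f (coords V) ^ 2)
                ∂(wilsonMeasure (d := 3) (L := (F.P K).sitesPerDir 0) (fundamentalRep (Fin 2)) ((γ * (F.P K).eps)⁻¹ / 2))) -
              (∫ V, f (coords V) ^ 2
                ∂(wilsonMeasure (d := 3) (L := (F.P K).sitesPerDir 0) (fundamentalRep (Fin 2)) ((γ * (F.P K).eps)⁻¹ / 2))) *
                Real.log (∫ V, f (coords V) ^ 2
                  ∂(wilsonMeasure (d := 3) (L := (F.P K).sitesPerDir 0) (fundamentalRep (Fin 2)) ((γ * (F.P K).eps)⁻¹ / 2)))) ≤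
          -∫ V, f (coords V) * gen V
            ∂(wilsonMeasure (d := 3) (L := (F.P K).sitesPerDir 0) (fundamentalRep (Fin 2)) ((γ * (F.P K).eps)⁻¹ / 2))) :
    ∃ γ₁ : ℝ, 0 < γ₁ ∧ ∀ (F : T3ContinuumYM3Torus.T3Family) (γ : ℝ), 0 < γ → γ ≤ γ₁ →
      ∃ c : ℝ, 0 < c ∧ ∃ K₀ : ℕ, ∀ K : ℕ, K₀ ≤ K →
        ∀ (m : ℕ) (i j : Fin m → Fin 3) (R T : Fin m → ℕ), 0 < ∑ k, (R k + T k) → ∀ δ : ℝ, 0 < δ →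
        ∀ (z : GaugeConfig 3 ((F.P K).sitesPerDir 0) (Matrix.specialUnitaryGroup (Fin 2) ℂ))
          (Ω : Type) (mΩ : MeasurableSpace Ω) (P : Measure Ω) (hP : IsProbabilityMeasure P)
          (W : ℝ≥0 → Ω → (Edge 3 ((F.P K).sitesPerDir 0) × NoiseIdx 2 → ℝ)) (hW : IsFlatBrownian W P)
          (U : ℝ≥0 → Ω → GaugeConfig 3 ((F.P K).sitesPerDir 0) (Matrix.specialUnitaryGroup (Fin 2) ℂ)),
          (∀ ω, U 0 ω = z) →
          (latticeLangevinDynamics (fundamentalLatticeRep 2) ((γ * (F.P K).eps)⁻¹ / 2)).IsSolution (fundamentalRep (Fin 2)) hW.natFiltration P W U →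
          ∀ s : ℝ, 2 * (F.P K).eps ≤ s →
            2 * (F.P K).eps + Real.log (((∑ k : Fin m, ((R k : ℝ) + T k)) * Real.sqrt (48 * (366 * |(γ * (F.P K).eps)⁻¹ / 2| + 3) / (c * (F.P K).eps))) / δ) / (2 * c) ≤ s →
            |(∫ ω, (∏ k : Fin m, (((Fintype.card (Site 3 ((F.P K).sitesPerDir 0)) : ℝ))⁻¹ * ∑ x : Site 3 ((F.P K).sitesPerDir 0), wilsonLoop (fundamentalRep (Fin 2)) x (i k) (j k) (R k) (T k) (U (s / (F.P K).eps).toNNReal ω))) ∂P) - ∫ V, (∏ k : Fin m, (((Fintype.card (Site 3 ((F.P K).sitesPerDir 0)) : ℝ))⁻¹ * ∑ x : Site 3 ((F.P K).sitesPerDir 0), wilsonLoop (fundamentalRep (Fin 2)) x (i k) (j k) (R k) (T k) V)) ∂(wilsonMeasure (d := 3) (L := ((F.P K).sitesPerDir 0)) (fundamentalRep (Fin 2)) ((γ * (F.P K).eps)⁻¹ / 2))| ≤ δ := by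
  obtain ⟨γ₁, hγ₁, h⟩ := nearUniform_loopString_coldStart_of_uniformLogSobolev hULS
  refine ⟨γ₁, hγ₁, fun F γ hγ hγ1 => ?_⟩
  obtain ⟨c, hc, K₀, hK⟩ := h F γ hγ hγ1
  refine ⟨c, hc, K₀, fun K hKK m i j R T hRT δ hδ z Ω mΩ P hP W hW U hU0 hU s h2 hs => ?_⟩
  have he : 0 < (F.P K).eps := (F.P K).eps_pos
  have hRT' : (0 : ℝ) < (∑ k : Fin m, ((R k : ℝ) + T k)) := by
    have h' : ((∑ k, (R k + T k) : ℕ) : ℝ) = (∑ k : Fin m, ((R k : ℝ) + T k)) := by push_cast; rfl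
    rw [← h']; exact_mod_cast hRT
  have hcε : 0 < c * (F.P K).eps := mul_pos hc he
  obtain ⟨hsplit, hu⟩ := toNNReal_div_eq_two_add he h2
  rw [hsplit]
  have hb := hK K hKK m i j R T hRT z Ω mΩ P hP W hW U hU0 hU (s / (F.P K).eps - 2).toNNReal
  refine hb.trans ?_
  obtain ⟨C, hC⟩ : ∃ C : ℝ, ((∑ k : Fin m, ((R k : ℝ) + T k)) * Real.sqrt (48 * (366 * |(γ * (F.P K).eps)⁻¹ / 2| + 3) / (c * (F.P K).eps))) = C := ⟨_, rfl⟩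
  rw [hC] at hs ⊢
  have hCpos : 0 < C := by rw [← hC]; positivity
  have hu' : Real.log (C / δ) ≤ 2 * c * (s - 2 * (F.P K).eps) := by
    have h1 : Real.log (C / δ) / (2 * c) ≤ s - 2 * (F.P K).eps := by linarith
    rw [div_le_iff₀ (by positivity)] at h1
    linarith
  have hexp : Real.exp (-(2 * (c * (F.P K).eps)) * (((s / (F.P K).eps - 2).toNNReal : ℝ≥0) : ℝ)) ≤ δ / C := by
    rw [hu]
    have e : -(2 * (c * (F.P K).eps)) * (s / (F.P K).eps - 2) = -(2 * c * (s - 2 * (F.P K).eps)) := by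
      field_simp
    rw [e]
    have h1 : Real.exp (-(2 * c * (s - 2 * (F.P K).eps))) ≤ Real.exp (-Real.log (C / δ)) := Real.exp_le_exp.2 (by linarith)
    rw [Real.exp_neg (Real.log (C / δ)), Real.exp_log (div_pos hCpos hδ), inv_div] at h1
    exact h1
  calc Real.exp (-(2 * (c * (F.P K).eps)) * (((s / (F.P K).eps - 2).toNNReal : ℝ≥0) : ℝ)) * C ≤ δ / C * C :=
        mul_le_mul_of_nonneg_right hexp hCpos.le
    _ = δ := div_mul_cancel₀ δ hCpos.ne'

end Summit.QuantumFields.YangMills.Theorems.ColdStartUniversality
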